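import Summits.CriticalPhenomena.Ising3DConformalLimit.Theorems.ArmHyperscalingMergingFloorGlue
import HarnessLib

/-!
# Line `one-arm-isotherm-lattice` for crux stmt-CriticalPhenomena-15592 (`MergingFloor`, route ArmHyperscaling)

Crux-strategist (before the lead); ALT line (primary: `limit-descent`). TRANSFER of the planar sibling's proof of
non-Gaussianity of the critical magnetisation field (Camia–Garban–Newman 2012/2016: one-arm exponent ⇒ critical
isotherm ⇒ non-Gaussian tails) to `ℤ³`, composed with the LIMIT → LATTICE descent, so that the lattice crux
`MergingFloor` is reached from this route's OTHER cruxes: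

  `OneArmHyperscaling` (item 15591, rank-2 crux of THIS route; stub S3 by name)
    ⟹ [S4, provable now: GHS tangent line + doubling lemma + MMS] matched upper critical isotherm at the CLT field scale
    ⟹ [S2, provable now: Lee–Yang product structure of the block law, Newman 1975] Binder floor `g_L ≥ 1/(2β_c²C²)`
    ⟹ [landed `gaussianLimitKillsBlockCoupling_proof`, item 4950] every non-degenerate pointwise limit has `U₄ ≢ 0`
    ⟹ [stub E = `WeylWindow.LimitExists`, item 4738, by name; paid on this route by `ExistsScaleCovariantLimit` 1981]
       descent to the lattice at the quadruple where `U₄^S < 0`: `MergingFloor`.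

Net effect, kernel-checked below (`MergingFloor_of`): on route ArmHyperscaling, `MergingFloor` ⇐ `OneArmHyperscaling` ∧
`LimitExists` ∧ (S2, S4 provable now) — ONE lattice number (15591) carries O(3) invariance (IsotropyFromOneArm), clause
(iii) at the limit (0636) AND the lattice merging floor; the crux is not an independent open problem of the route.
Stubs S2/S3/S4 are VERBATIM the stubs of line `isotherm-saturation-lee-yang` of crux 0636 (skelvet PASS 2026-08-17), so a
prover closing them there closes them here (`--supports` both items); the compositions `binder_lower_of_saturation`,
`eventually_binder_ge`, `exists_normalised`, `nonGaussian_of` are that line's kernel-checked glue, re-derived here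
(Cruxes files are not imported across crux directories).

Lead (prover-line-stmt-CriticalPhenomena-15592-0, 2026-08-17): S2 LANDED p158504
(`Theorems/ArmHyperscalingMergingFloorLeeYangDeficit.lean`), S4 LANDED p158638
(`Theorems/ArmHyperscalingMergingFloorOneArmGivesMatchedIsotherm.lean`); the two remaining sorries are the two OPEN ITEMS by
name (S3 = stmt-CriticalPhenomena-15591, E = stmt-CriticalPhenomena-4738).

GLUE LANDED p159248 (`Theorems/ArmHyperscalingMergingFloorGlue.lean`): `mergingFloor_of_oneArmHyperscaling_of_limitExists :
OneArmHyperscaling → LimitExists → MergingFloor` (registered glue stub), the payer edge `nonGaussian_of_oneArmHyperscaling :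
OneArmHyperscaling → IsingEuclidUpgradeR4NonGaussian` (item 15591 ⟹ item 0636), `mergingFloor_of_limitExists_of_nonGaussian`
(4738 ∧ 0636 ⟹ crux) and `mergingFloor_of_oneArmHyperscaling_of_existsScaleCovariantLimit` (15591 ∧ 1981 ⟹ crux: on THIS route
the crux is implied by cruxes #2 and #4). This skeleton is now that glue applied to the two OPEN ITEMS by name.

`lean check`: sorries ONLY in `stub_oneArmHyperscaling`, `stub_limitExists`; `MergingFloor_of` concludes the crux BY NAME.
[cite: AizenmanDuminilCopinAnnals2021, eq. (3.11)] [cite: CamiaGarbanNewman2016, Thm 1.2] [cite: Newman1975, Thm 3]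
-/

noncomputable section

namespace Summit.CriticalPhenomena.Ising3DConformalLimit.Cruxes.MergingFloor.OneArmIsothermLattice

open Literature.Probability.LatticeModels Filter Set Finset
open scoped Topology BigOperators
open Summit.CriticalPhenomena.Ising3DConformalLimit.Theses

/-! ## Registered stubs (the two open items, by name) -/

/-- **Stub E — BARE EXISTENCE of a non-degenerate full-filter pointwise limit** (OPEN; = item stmt-CriticalPhenomena-4738
`WeylWindow.LimitExists`, by name; on this route it is implied by the crux `ExistsScaleCovariantLimit` 1981 by forgetting,
`MergingFloor_of_route`). It is the typed lattice surplus of `MergingFloor` over clause (iii): the descent limit → lattice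
needs the full-filter limit at the 6+1 configurations of one quadruple. -/
theorem stub_limitExists : WeylWindow.LimitExists := by
  sorry

/-- **S3 — ONE-ARM HYPERSCALING** (OPEN, the existing shared crux stmt-CriticalPhenomena-15591 of route
ArmHyperscaling, by name; its own chain `Cruxes/OneArmHyperscaling`, line `mirror-face-saturation`, open core
`stub_faceSaturation`): `∃ K ≥ 1, C, ∀ n ≥ 1, (⟨σ₀⟩⁺_{box(Kn)})² ≤ C ⟨σ₀σ_{2ne₀}⟩_{β_c}`. -/
theorem stub_oneArmHyperscaling :
    Summit.CriticalPhenomena.Ising3DConformalLimit.Theses.ArmHyperscaling.OneArmHyperscaling := by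
  sorry

/-! ## Landed stubs (proved in Theorems/, referenced through the glue import)

* S2 `stub_leeYangDeficit` = `Summit.CriticalPhenomena.Ising3DConformalLimit.ArmHyperscalingMergingFloor.stub_leeYangDeficit`
  (p158504, `Theorems/ArmHyperscalingMergingFloorLeeYangDeficit.lean`);
* S4 `stub_oneArmGivesMatchedIsotherm` =
  `Summit.CriticalPhenomena.Ising3DConformalLimit.ArmHyperscalingMergingFloor.stub_oneArmGivesMatchedIsotherm`
  (p158638, `Theorems/ArmHyperscalingMergingFloorOneArmGivesMatchedIsotherm.lean`). -/

/-! ## Composition (sorry-free; all glue LANDED in `Theorems/ArmHyperscalingMergingFloorGlue.lean`) -/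

/-- **PAYER EDGE 15591 ⟹ 0636** (landed): one-arm hyperscaling gives clause (iii) at the limit. [folklore] -/
theorem nonGaussian_of_oneArm :
    ArmHyperscaling.OneArmHyperscaling → IsingEuclidUpgrade.IsingEuclidUpgradeR4NonGaussian :=
  Summit.CriticalPhenomena.Ising3DConformalLimit.ArmHyperscalingMergingFloor.nonGaussian_of_oneArmHyperscaling

/-- **COMPOSITION — the crux BY NAME from EXACTLY the two open stub statements** (landed glue stub
`mergingFloor_of_oneArmHyperscaling_of_limitExists`). [folklore] -/
theorem MergingFloor_of :
    ArmHyperscaling.OneArmHyperscaling → WeylWindow.LimitExists → ArmHyperscaling.MergingFloor :=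
  Summit.CriticalPhenomena.Ising3DConformalLimit.ArmHyperscalingMergingFloor.mergingFloor_of_oneArmHyperscaling_of_limitExists

/-- The `limit-descent` reading (landed): crux ⇐ items 4738 ∧ 0636. [folklore] -/
theorem MergingFloor_of_subs :
    WeylWindow.LimitExists → IsingEuclidUpgrade.IsingEuclidUpgradeR4NonGaussian → ArmHyperscaling.MergingFloor :=
  Summit.CriticalPhenomena.Ising3DConformalLimit.ArmHyperscalingMergingFloor.mergingFloor_of_limitExists_of_nonGaussian

/-- On route ArmHyperscaling the existence stub is paid by the route's own crux `ExistsScaleCovariantLimit`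
(item stmt-CriticalPhenomena-1981): `MergingFloor` ⇐ cruxes #2 ∧ #4 (landed). [folklore] -/
theorem MergingFloor_of_route :
    ArmHyperscaling.OneArmHyperscaling → ArmHyperscaling.ExistsScaleCovariantLimit → ArmHyperscaling.MergingFloor :=
  Summit.CriticalPhenomena.Ising3DConformalLimit.ArmHyperscalingMergingFloor.mergingFloor_of_oneArmHyperscaling_of_existsScaleCovariantLimit

/-- The crux from the registered stubs (closes when items 15591 and 4738 close). -/
theorem MergingFloor_proof : ArmHyperscaling.MergingFloor :=
  MergingFloor_of stub_oneArmHyperscaling stub_limitExists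

end Summit.CriticalPhenomena.Ising3DConformalLimit.Cruxes.MergingFloor.OneArmIsothermLattice

end
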